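import Mathlib
import Literature.NumberTheory.LFunctions.Zhang2022.TypedSection10B
import Literature.NumberTheory.LFunctions.Zhang2022.Section8ChangeOfVariables
import Literature.NumberTheory.LFunctions.Zhang2022.Section10Theta1Evals
import HarnessLib

/-!
# Zhang (2022) §10: the two "gathering" steps of the evaluations of `Θ₁(𝐚₁₁,𝐚₁₃)` and
# `Θ₁(𝐚₁₃,𝐚₂₁)` (Z22:§10.u040, Z22:§10.u045) are kernel EDGES

Topic `Literature/NumberTheory/LFunctions/Zhang2022` (Landau–Siegel audit tree; verdict-neutral).
Y. Zhang, *Discrete mean estimates and the Landau–Siegel zero*, arXiv:2211.02515v1 (2022)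
[Zhang2022LandauSiegel], §10 pp. 57–59 (tex L2921–L3012) — **an unrefereed manuscript under
adjudication; this file proves two pieces of BOOKKEEPING of its §10 and asserts nothing about its
Theorems 1–2.** The typed statements are L3-t2's (`TypedSection10B.lean`, namespace `…Typed.Sec10B`);
here (same namespace, theorem-only, 0 new definitions, 0 facts):

* `concl1321_of_ranges` — **Z22:§10.u045** "Gathering these results together we conclude
  `α⁻¹S_j(𝐚₁₃,𝐚₂₁) = d₄ⱼ𝔞 + o(1)`" (p. 59) FOLLOWS from the expansion `IdSj1321` (u042), the split
  `Split1321`, "the sum over `dr < P^{0.5}` is `o(α)`" (`Small1321`) and the two range evaluations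
  `Eq1043a/b`, `Eq1044a/b` (u043–u044): the printed integral forms add up to `d₄ⱼ·𝔞·α` EXACTLY
  (`key1321`: substitutions `u = 0.504 − z`, `v = u − 0.002`, and `α·log P = π`; `d₄ⱼ` = the tree's
  `d4F j 𝔤𝔥_{j6}` = `d4Sel j`).
* `concl1113_of_ranges` — **Z22:§10.u040** "gathering the above results together we conclude
  `α⁻¹S_j(𝐚₁₁,𝐚₁₃) = d₃ⱼ𝔞 + o(1)`" (p. 58) FOLLOWS from `IdSj1113` (u034), `Split1113` (u035), the
  three range evaluations `Eq1036a/b/c`, `Eq1037a/b`, `Eq1038a/b` (u036–u038), the β-product step u039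
  in its EXPLICIT form (`betaProd_remainder_le`: `‖β_{j+1}β_{j+2}log P + (11−6j+j²)πα‖ ≤
  πα·(α𝓛)·(18|c′|+21c′²)`, `α𝓛 = π/𝓛⁸`; the `o(α)` node itself is `Section10BetaProd.betaProd1039_holds`)
  and the tree's `𝔞 ≤ (96e⁹/π²)𝓛⁴` (`Skeleton.frakA_le_ell_pow_four`) — the latter because u040 claims
  `o(1)` and not `o(𝔞)`, so the cross term `𝔞·(β-remainder/α)·I₁/500 = O(𝓛⁴·𝓛⁻⁸)` must be shown to
  vanish; the rest is the exact identity `key1113` (`u = 0.504 − z`, `α log P = π`; `d₃ⱼ` = the tree's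
  `d3F (11−6j+j²) 𝔣𝔣_{j6} 𝔣𝔣_{j7} 𝔶𝔶₁ⱼ 𝔶𝔶₂ⱼ` = `d3Sel j`).

So the two gathering nodes carry no content beyond the range claims they gather (which remain CLAIMS:
Lemmas 10.1–10.2, 8.2–8.4 and the §8 evaluation rule behind them are not proved here).

## References

* Y. Zhang, arXiv:2211.02515v1 (2022), §10 pp. 57–59; §2 (2.10), (2.13); §8 (8.13)–(8.18).
  [cite: Zhang2022LandauSiegel, §10 pp. 57–59]
-/

noncomputable section

open Complex Real MeasureTheory intervalIntegral
open Literature.NumberTheory.LFunctions.Zhang2022.Skeleton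

namespace Literature.NumberTheory.LFunctions.Zhang2022.Typed.Sec10B

/-- `Z22:§10.u045` (helper) `𝔤𝔥_{j6}` is continuous. [folklore] -/
private theorem continuous_ghSel (j μ : ℕ) : Continuous (ghSel j μ) := by
  unfold ghSel
  split_ifs <;> exact continuous_ghF _ _ _ _

/-- `Z22:§10.u045` (helper) `d₄ⱼ = d4F j 𝔤𝔥_{j6}` for `j = 1, 2, 3`. [cite: Zhang2022LandauSiegel, §10 p. 59] -/
private theorem d4Sel_eq {j : ℕ} (hj : j ∈ ({1, 2, 3} : Finset ℕ)) : d4Sel j = d4F j (ghSel j 6) := by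
  simp only [Finset.mem_insert, Finset.mem_singleton] at hj
  rcases hj with rfl | rfl | rfl <;> simp [d4Sel, ghSel, d41, d42, d43]

/-- `Z22:§10.u045` (helper) `α > 0` once `D ≥ 2`. [cite: Zhang2022LandauSiegel, §2 (2.10)] -/
private theorem alpha_pos {D : ℕ} (hD : 2 ≤ D) : 0 < alpha D := by
  rw [alpha, bigP, Real.log_exp]
  have : 0 < ell D := by
    rw [ell]; exact Real.log_pos (by exact_mod_cast hD)
  positivity

/-- `Z22:§10.u045` (helper) `α · log P = π`. [cite: Zhang2022LandauSiegel, §2 (2.10)] -/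
private theorem alpha_mul_logP {D : ℕ} (hD : 2 ≤ D) : alpha D * logP D = π := by
  have hℓ : 0 < ell D := by rw [ell]; exact Real.log_pos (by exact_mod_cast hD)
  rw [alpha, logP, bigP, Real.log_exp]
  field_simp

/-- `Z22:§10.u045` (helper) the two substitutions `u = 0.504 − z` behind "Gathering these results":
`∫_{0.5}^{0.502}(−1 − πij(z − 0.5))g(0.504 − z)dz + ∫_{0.502}^{0.504}(1 − πij(0.504 − z))g(0.504 − z)dz
 = ∫₀^{0.002}((−1 − πij(0.002 − v))g(0.002 + v) + (1 − πijv)g(v))dv`. [folklore] -/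
private theorem subst1321 {g : ℝ → ℂ} (hg : Continuous g) (j : ℕ) :
    (∫ z in (0.5 : ℝ)..0.502, (-1 - π * I * j * (z - 0.5)) * g (0.504 - z)) +
      (∫ z in (0.502 : ℝ)..0.504, (1 - π * I * j * (0.504 - z)) * g (0.504 - z)) =
    ∫ v in (0 : ℝ)..0.002,
      ((-1 - π * I * j * (((0.002 - v : ℝ)) : ℂ)) * g (0.002 + v) + (1 - π * I * j * (v : ℂ)) * g v) := by
  -- first integral: F(u) = (-1 - πij(0.004 - u)) g(u), z ↦ 0.504 - z, then u = v + 0.002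
  set F : ℝ → ℂ := fun u => (-1 - π * I * j * (((0.004 - u : ℝ)) : ℂ)) * g u with hF
  have h1 : (∫ z in (0.5 : ℝ)..0.502, (-1 - π * I * j * (z - 0.5)) * g (0.504 - z)) =
      ∫ z in (0.5 : ℝ)..0.502, F (0.504 - z) := by
    refine intervalIntegral.integral_congr fun z _ => ?_
    simp only [hF]
    push_cast
    ring
  have h1' : (∫ z in (0.5 : ℝ)..0.502, F (0.504 - z)) = ∫ u in (0.002 : ℝ)..0.004, F u := by
    rw [intervalIntegral.integral_comp_sub_left (fun u => F u) (0.504 : ℝ)]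
    norm_num
  have h1'' : (∫ u in (0.002 : ℝ)..0.004, F u) = ∫ v in (0 : ℝ)..0.002, F (v + 0.002) := by
    rw [intervalIntegral.integral_comp_add_right (fun u => F u) (0.002 : ℝ)]
    norm_num
  -- second integral: G(u) = (1 - πiju) g(u), z ↦ 0.504 - z
  set G : ℝ → ℂ := fun u => (1 - π * I * j * (u : ℂ)) * g u with hG
  have h2 : (∫ z in (0.502 : ℝ)..0.504, (1 - π * I * j * (0.504 - z)) * g (0.504 - z)) =
      ∫ z in (0.502 : ℝ)..0.504, G (0.504 - z) := by
    refine intervalIntegral.integral_congr fun z _ => ?_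
    simp only [hG]
    push_cast
    ring
  have h2' : (∫ z in (0.502 : ℝ)..0.504, G (0.504 - z)) = ∫ u in (0 : ℝ)..0.002, G u := by
    rw [intervalIntegral.integral_comp_sub_left (fun u => G u) (0.504 : ℝ)]
    norm_num
  rw [h1, h1', h1'', h2, h2']
  have hFi : IntervalIntegrable (fun v => F (v + 0.002)) volume (0 : ℝ) 0.002 := by
    apply Continuous.intervalIntegrable
    simp only [hF]
    fun_prop
  have hGi : IntervalIntegrable (fun u => G u) volume (0 : ℝ) 0.002 := by
    apply Continuous.intervalIntegrable
    simp only [hG]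
    fun_prop
  rw [← intervalIntegral.integral_add hFi hGi]
  refine intervalIntegral.integral_congr fun v _ => ?_
  simp only [hF, hG]
  have : (0.004 : ℝ) - (v + 0.002) = 0.002 - v := by ring
  rw [this, add_comm v 0.002]

/-- `Z22:§10.u045` (helper) the printed `d₄ⱼ` (tree `d4F`) as ONE integral over `[0, 0.002]`.
[cite: Zhang2022LandauSiegel, §10 p. 59] -/
private theorem d4F_eq_integral {g : ℝ → ℂ} (hg : Continuous g) (j : ℕ) :
    d4F j g = ∫ v in (0 : ℝ)..0.002,
      ((((500 / (0.504 * π) : ℝ)) : ℂ) * (g v - g (0.002 + v)) -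
        500 * I * (j : ℂ) / 0.504 * (g (0.002 + v) * (((0.002 - v : ℝ)) : ℂ) + g v * (v : ℂ))) := by
  have hI : IntervalIntegrable (fun v : ℝ => (((500 / (0.504 * π) : ℝ)) : ℂ) * (g v - g (0.002 + v)))
      volume (0 : ℝ) 0.002 := by
    apply Continuous.intervalIntegrable; fun_prop
  have hJ : IntervalIntegrable (fun v : ℝ =>
      500 * I * (j : ℂ) / 0.504 * (g (0.002 + v) * (((0.002 - v : ℝ)) : ℂ) + g v * (v : ℂ)))
      volume (0 : ℝ) 0.002 := by
    apply Continuous.intervalIntegrable; fun_prop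
  rw [intervalIntegral.integral_sub hI hJ, intervalIntegral.integral_const_mul,
    intervalIntegral.integral_const_mul, d4F]

/-- `Z22:§10.u045` (helper) the EXACT main-order identity behind "Gathering these results together":
with `L·α = π` (`log P · α = π`),
`α⁻¹·(500A/(0.504L))·(∫_{0.5}^{0.502}(−1 − πij(z−0.5))g(0.504−z) + ∫_{0.502}^{0.504}(1 − πij(0.504−z))g(0.504−z)) = d4F j g · A`.
[cite: Zhang2022LandauSiegel, §10 p. 59] -/
private theorem key1321 {A α L : ℝ} (hα : α ≠ 0) (hL : L * α = π) {g : ℝ → ℂ} (hg : Continuous g)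
    (j : ℕ) :
    (500 * (A : ℂ) / (0.504 * (L : ℂ)) *
          (∫ z in (0.5 : ℝ)..0.502, (-1 - π * I * j * (z - 0.5)) * g (0.504 - z)) +
        500 * (A : ℂ) / (0.504 * (L : ℂ)) *
          (∫ z in (0.502 : ℝ)..0.504, (1 - π * I * j * (0.504 - z)) * g (0.504 - z))) / (α : ℂ) =
      d4F j g * A := by
  rw [← mul_add, subst1321 hg j, mul_comm (d4F j g) (A : ℂ), d4F_eq_integral hg j,
    mul_div_right_comm, ← intervalIntegral.integral_const_mul, ← intervalIntegral.integral_const_mul]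
  refine intervalIntegral.integral_congr fun v _ => ?_
  have hα' : (α : ℂ) ≠ 0 := by exact_mod_cast hα
  have hπ : (π : ℂ) ≠ 0 := by exact_mod_cast Real.pi_ne_zero
  have hL' : (L : ℂ) = π / α := by
    rw [eq_div_iff hα']
    exact_mod_cast hL
  simp only [hL']
  push_cast
  field_simp
  ring

/-- `Z22:§10.u045` (helper) the `o(α)` bookkeeping of the gathering step, divided by `α`. [folklore] -/
private theorem gather_bound {R1 R2 R3 A2 A3 B2 B3 M : ℂ} {α ε : ℝ} (hα : 0 < α)
    (e1 : ‖R1‖ ≤ ε / 5 * α) (e2 : ‖R2 - A2‖ ≤ ε / 5 * α) (e3 : ‖A2 - B2‖ ≤ ε / 5 * α)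
    (e4 : ‖R3 - A3‖ ≤ ε / 5 * α) (e5 : ‖A3 - B3‖ ≤ ε / 5 * α) (key : (B2 + B3) / (α : ℂ) = M) :
    ‖(R1 + R2 + R3) / (α : ℂ) - M‖ ≤ ε := by
  have h : (R1 + R2 + R3) / (α : ℂ) - M =
      (R1 + (R2 - A2) + (A2 - B2) + (R3 - A3) + (A3 - B3)) / (α : ℂ) := by
    rw [← key]; ring
  rw [h, norm_div, Complex.norm_real, Real.norm_of_nonneg hα.le, div_le_iff₀ hα]
  calc ‖R1 + (R2 - A2) + (A2 - B2) + (R3 - A3) + (A3 - B3)‖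
      ≤ ‖R1‖ + ‖R2 - A2‖ + ‖A2 - B2‖ + ‖R3 - A3‖ + ‖A3 - B3‖ := by
        refine (norm_add_le _ _).trans ?_
        gcongr
        refine (norm_add_le _ _).trans ?_
        gcongr
        refine (norm_add_le _ _).trans ?_
        gcongr
        exact norm_add_le _ _
    _ ≤ 5 * (ε / 5 * α) := by linarith
    _ = ε * α := by ring

/-- `Z22:§10.u045` EDGE (kernel-proved): **"Gathering these results together we conclude
`α⁻¹S_j(𝐚₁₃,𝐚₂₁) = d₄ⱼ𝔞 + o(1)`"** (p. 59) FOLLOWS from the typed steps of the evaluation of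
`Θ₁(𝐚₁₃,𝐚₂₁)` — the expansion `IdSj1321` (u042), the range split `Split1321`, "the sum over `dr < P^{0.5}`
is `o(α)`" (`Small1321`), and the two range evaluations `Eq1043a/b`, `Eq1044a/b` (u043, u044) — by the
two substitutions `u = 0.504 − z` and `α log P = π`: the integral forms add up to `d₄ⱼ𝔞α` EXACTLY
(`key1321`; `d₄ⱼ` = tree `d4F j 𝔤𝔥_{j6}` = `d4Sel j`). So u045 carries no content beyond u042–u044.
[cite: Zhang2022LandauSiegel, §10 p. 59] -/
theorem concl1321_of_ranges (c' : ℝ) (hId : IdSj1321 c') (hSplit : Split1321 c')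
    (hSmall : Small1321 c') (h43a : Eq1043a c') (h43b : Eq1043b c') (h44a : Eq1044a c')
    (h44b : Eq1044b c') : Concl1321 c' := by
  intro ε hε
  have hε5 : 0 < ε / 5 := by positivity
  obtain ⟨D₀, hD₀⟩ :=
    ((((hSmall _ hε5).and (h43a _ hε5)).and (h43b _ hε5)).and (h44a _ hε5)).and (h44b _ hε5)
  refine ⟨max D₀ 2, fun D _ χ hD hq hp hA j hj => ?_⟩
  obtain ⟨⟨⟨⟨e1, e2⟩, e3⟩, e4⟩, e5⟩ := hD₀ D χ (le_of_max_le_left hD) hq hp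
  have hD2 : 2 ≤ D := le_of_max_le_right hD
  have hα := alpha_pos hD2
  rw [hId D χ hq j, hSplit D χ j]
  exact gather_bound hα (e1 hA j hj) (e2 hA j hj) (e3 hA j hj) (e4 hA j hj) (e5 hA j hj)
    (by rw [d4Sel_eq hj]
        exact key1321 hα.ne' (by rw [mul_comm]; exact alpha_mul_logP hD2) (continuous_ghSel j 6) j)

/-! ## The gathering step of `Θ₁(𝐚₁₁,𝐚₁₃)` — Z22:§10.u040 -/

/-- `Z22:§10.u040` (helper) `𝔣𝔣_{jμ}` is continuous. [folklore] -/
private theorem continuous_ffSel (j μ : ℕ) : Continuous (ffSel j μ) := by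
  unfold ffSel
  split_ifs <;> exact continuous_ffF _ _

/-- `Z22:§10.u040` (helper) `𝔶𝔶₁ⱼ`, `𝔶𝔶₂ⱼ` are continuous. [folklore] -/
private theorem continuous_yy1Sel (j : ℕ) : Continuous (yy1Sel j) := by
  unfold yy1Sel yy11 yy12 yy13 yy1F
  split_ifs <;> fun_prop

/-- `Z22:§10.u040` (helper) `𝔶𝔶₂ⱼ` is continuous. [folklore] -/
private theorem continuous_yy2Sel (j : ℕ) : Continuous (yy2Sel j) := by
  unfold yy2Sel yy21 yy22 yy23 yy2F
  split_ifs <;> fun_prop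

/-- `Z22:§10.u040` (helper) `d₃ⱼ = d3F (11 − 6j + j²) 𝔣𝔣_{j6} 𝔣𝔣_{j7} 𝔶𝔶₁ⱼ 𝔶𝔶₂ⱼ` with `11 − 6j + j² = 6, 3, 2`.
[cite: Zhang2022LandauSiegel, §10 p. 58] -/
private theorem d3Sel_eq {j : ℕ} (hj : j ∈ ({1, 2, 3} : Finset ℕ)) :
    ∃ n : ℕ, (n : ℂ) = nQuad j ∧ d3Sel j = d3F n (ffSel j 6) (ffSel j 7) (yy1Sel j) (yy2Sel j) := by
  simp only [Finset.mem_insert, Finset.mem_singleton] at hj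
  rcases hj with rfl | rfl | rfl
  · exact ⟨6, by norm_num [nQuad], by simp [d3Sel, ffSel, yy1Sel, yy2Sel, d31]⟩
  · exact ⟨3, by norm_num [nQuad], by simp [d3Sel, ffSel, yy1Sel, yy2Sel, d32]⟩
  · exact ⟨2, by norm_num [nQuad], by simp [d3Sel, ffSel, yy1Sel, yy2Sel, d33]⟩

/-- `Z22:§10.u040` (helper) the substitution `u = 0.504 − z` in the two upper ranges:
`∫_{0.5}^{0.502} f(0.504−z)(−1 + y₁(z))dz + ∫_{0.502}^{0.504} f(0.504−z)(1 + y₂(z))dz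
 = ∫₀^{0.002}(f(u) − f(0.002+u))du + (∫_{0.5}^{0.502} f(0.504−z)y₁(z)dz + ∫_{0.502}^{0.504} f(0.504−z)y₂(z)dz)`.
[folklore] -/
private theorem subst1113 {f y1 y2 : ℝ → ℂ} (hf : Continuous f) (hy1 : Continuous y1)
    (hy2 : Continuous y2) :
    (∫ z in (0.5 : ℝ)..0.502, f (0.504 - z) * (-1 + y1 z)) +
      (∫ z in (0.502 : ℝ)..0.504, f (0.504 - z) * (1 + y2 z)) =
    (∫ u in (0 : ℝ)..0.002, (f u - f (0.002 + u))) +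
      ((∫ z in (0.5 : ℝ)..0.502, f (0.504 - z) * y1 z) +
        ∫ z in (0.502 : ℝ)..0.504, f (0.504 - z) * y2 z) := by
  have hfc : Continuous fun z : ℝ => f (0.504 - z) := hf.comp (by fun_prop)
  have i1 : IntervalIntegrable (fun z : ℝ => -f (0.504 - z)) volume (0.5 : ℝ) 0.502 :=
    hfc.neg.intervalIntegrable _ _
  have i2 : IntervalIntegrable (fun z : ℝ => f (0.504 - z) * y1 z) volume (0.5 : ℝ) 0.502 :=
    (hfc.mul hy1).intervalIntegrable _ _
  have i3 : IntervalIntegrable (fun z : ℝ => f (0.504 - z)) volume (0.502 : ℝ) 0.504 :=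
    hfc.intervalIntegrable _ _
  have i4 : IntervalIntegrable (fun z : ℝ => f (0.504 - z) * y2 z) volume (0.502 : ℝ) 0.504 :=
    (hfc.mul hy2).intervalIntegrable _ _
  have e1 : (∫ z in (0.5 : ℝ)..0.502, f (0.504 - z) * (-1 + y1 z)) =
      (∫ z in (0.5 : ℝ)..0.502, -f (0.504 - z)) + ∫ z in (0.5 : ℝ)..0.502, f (0.504 - z) * y1 z := by
    rw [← intervalIntegral.integral_add i1 i2]
    refine intervalIntegral.integral_congr fun z _ => ?_
    ring
  have e2 : (∫ z in (0.502 : ℝ)..0.504, f (0.504 - z) * (1 + y2 z)) =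
      (∫ z in (0.502 : ℝ)..0.504, f (0.504 - z)) + ∫ z in (0.502 : ℝ)..0.504, f (0.504 - z) * y2 z := by
    rw [← intervalIntegral.integral_add i3 i4]
    refine intervalIntegral.integral_congr fun z _ => ?_
    ring
  have e3 : (∫ z in (0.5 : ℝ)..0.502, -f (0.504 - z)) = -∫ v in (0 : ℝ)..0.002, f (0.002 + v) := by
    rw [intervalIntegral.integral_neg, intervalIntegral.integral_comp_sub_left (fun u => f u) (0.504 : ℝ)]
    norm_num
  have e4 : (∫ z in (0.502 : ℝ)..0.504, f (0.504 - z)) = ∫ v in (0 : ℝ)..0.002, f v := by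
    rw [intervalIntegral.integral_comp_sub_left (fun u => f u) (0.504 : ℝ)]
    norm_num
  have i5 : IntervalIntegrable (fun v : ℝ => f v) volume (0 : ℝ) 0.002 := hf.intervalIntegrable _ _
  have i6 : IntervalIntegrable (fun v : ℝ => f (0.002 + v)) volume (0 : ℝ) 0.002 :=
    (hf.comp (by fun_prop)).intervalIntegrable _ _
  rw [e1, e2, e3, e4, intervalIntegral.integral_sub i5 i6]
  ring

/-- `Z22:§10.u040` (helper) `‖ι₂‖ ≤ 12/5` (`ι₂ = 0.94977 − 1.38995i`). [cite: Zhang2022LandauSiegel, §2 (2.26)] -/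
private theorem norm_iota2_le : ‖iota2‖ ≤ 12 / 5 := by
  rw [iota2]
  refine (norm_sub_le _ _).trans ?_
  rw [norm_mul, Complex.norm_I, mul_one]
  have h1 : ‖(0.94977 : ℂ)‖ = 0.94977 := by
    rw [show (0.94977 : ℂ) = ((0.94977 : ℝ) : ℂ) by norm_num, Complex.norm_real, Real.norm_of_nonneg]
    norm_num
  have h2 : ‖(1.38995 : ℂ)‖ = 1.38995 := by
    rw [show (1.38995 : ℂ) = ((1.38995 : ℝ) : ℂ) by norm_num, Complex.norm_real, Real.norm_of_nonneg]
    norm_num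
  rw [h1, h2]
  norm_num

/-- `Z22:§10.u040` (helper) `|𝔣𝔣(z)| ≤ 1 + |a|π|z|` for the shape `(1 + aπiz)e^{kπiz}`.
[cite: Zhang2022LandauSiegel, §8 (8.13)–(8.18)] -/
private theorem norm_ffF_le (a k : ℚ) (z : ℝ) : ‖ffF a k z‖ ≤ 1 + |(a : ℝ)| * π * |z| := by
  rw [ffF, norm_mul]
  have he : ‖cexp (k * π * I * z)‖ = 1 := by
    rw [show (k : ℂ) * π * I * z = (((k : ℝ) * π * z : ℝ) : ℂ) * I by push_cast; ring,
      Complex.norm_exp_ofReal_mul_I]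
  rw [he, mul_one]
  refine (norm_add_le _ _).trans ?_
  rw [norm_one]
  gcongr
  rw [show (a : ℂ) * π * I * z = (((a : ℝ) * π * z : ℝ) : ℂ) * I by push_cast; ring, norm_mul,
    Complex.norm_I, mul_one, Complex.norm_real, Real.norm_eq_abs, abs_mul, abs_mul,
    abs_of_pos Real.pi_pos]

/-- `Z22:§10.u040` (helper) `|𝔣𝔣_{jμ}(z)| ≤ 4` on `|z| ≤ 0.504` (all six have `|a| ≤ 3/2`).
[cite: Zhang2022LandauSiegel, §8 (8.13)–(8.18)] -/
private theorem norm_ffSel_le (j μ : ℕ) {z : ℝ} (hz : |z| ≤ 0.504) : ‖ffSel j μ z‖ ≤ 4 := by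
  have hπ := Real.pi_lt_d2
  have key : ∀ a k : ℚ, |(a : ℝ)| ≤ 3 / 2 → ‖ffF a k z‖ ≤ 4 := by
    intro a k ha
    refine (norm_ffF_le a k z).trans ?_
    have : |(a : ℝ)| * π * |z| ≤ 3 / 2 * 3.15 * 0.504 := by
      gcongr
    linarith
  unfold ffSel ff16 ff26 ff36 ff17 ff27 ff37
  split_ifs <;> exact key _ _ (by norm_num)

/-- `Z22:§10.u040` (helper) `|∫₀^{0.5}(𝔣𝔣_{j6}(0.004+z)/0.504 + ι₂𝔣𝔣_{j7}(z)/0.5)dz| ≤ 14`. [folklore] -/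
private theorem norm_I1_le (j : ℕ) :
    ‖∫ z in (0 : ℝ)..0.5, (ffSel j 6 (0.004 + z) / 0.504 + iota2 * ffSel j 7 z / 0.5)‖ ≤ 14 := by
  have h504 : ‖(0.504 : ℂ)‖ = 0.504 := by
    rw [show (0.504 : ℂ) = ((0.504 : ℝ) : ℂ) by norm_num, Complex.norm_real, Real.norm_of_nonneg]
    norm_num
  have h5 : ‖(0.5 : ℂ)‖ = 0.5 := by
    rw [show (0.5 : ℂ) = ((0.5 : ℝ) : ℂ) by norm_num, Complex.norm_real, Real.norm_of_nonneg]
    norm_num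
  have h : ∀ z ∈ Set.uIoc (0 : ℝ) 0.5,
      ‖ffSel j 6 (0.004 + z) / 0.504 + iota2 * ffSel j 7 z / 0.5‖ ≤ 28 := by
    intro z hz
    rw [Set.uIoc_of_le (by norm_num)] at hz
    obtain ⟨hz0, hz1⟩ := hz
    have b6 : ‖ffSel j 6 (0.004 + z)‖ ≤ 4 :=
      norm_ffSel_le j 6 (by rw [abs_of_nonneg (by linarith)]; linarith)
    have b7 : ‖ffSel j 7 z‖ ≤ 4 := norm_ffSel_le j 7 (by rw [abs_of_nonneg hz0.le]; linarith)
    calc ‖ffSel j 6 (0.004 + z) / 0.504 + iota2 * ffSel j 7 z / 0.5‖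
        ≤ ‖ffSel j 6 (0.004 + z) / 0.504‖ + ‖iota2 * ffSel j 7 z / 0.5‖ := norm_add_le _ _
      _ = ‖ffSel j 6 (0.004 + z)‖ / 0.504 + ‖iota2‖ * ‖ffSel j 7 z‖ / 0.5 := by
          rw [norm_div, norm_div, norm_mul, h504, h5]
      _ ≤ 4 / 0.504 + 12 / 5 * 4 / 0.5 := by
          gcongr
          exact norm_iota2_le
      _ ≤ 28 := by norm_num
  refine (intervalIntegral.norm_integral_le_of_norm_le_const h).trans ?_
  norm_num

/-- `Z22:§10.u040` (helper) `log D ≥ L` once `D ≥ ⌈e^L⌉`. [folklore] -/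
private theorem le_ell_of_ceil_exp_le {L : ℝ} {D : ℕ} (hD : ⌈Real.exp L⌉₊ ≤ D) : L ≤ ell D := by
  rw [ell]
  have hD' : Real.exp L ≤ (D : ℝ) := (Nat.le_ceil _).trans (by exact_mod_cast hD)
  have hpos : (0 : ℝ) < D := (Real.exp_pos L).trans_le hD'
  exact (Real.le_log_iff_exp_le hpos).mpr hD'

/-- `Z22:§10.u040` (helper) `|πα·u·(Ac′ + Bc′²u)| ≤ πα·u·(|A||c′| + |B|c′²)` for `0 ≤ u ≤ 1`. [folklore] -/
private theorem abs_remainder_le {α u c A B : ℝ} (hα : 0 ≤ α) (hu0 : 0 ≤ u) (hu1 : u ≤ 1) :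
    |π * α * u * (A * c + B * c ^ 2 * u)| ≤ π * α * u * (|A| * |c| + |B| * c ^ 2) := by
  rw [abs_mul, abs_of_nonneg (by positivity : 0 ≤ π * α * u)]
  gcongr
  calc |A * c + B * c ^ 2 * u| ≤ |A * c| + |B * c ^ 2 * u| := abs_add_le _ _
    _ = |A| * |c| + |B| * c ^ 2 * u := by
        rw [abs_mul, abs_mul, abs_mul, abs_of_nonneg (sq_nonneg c), abs_of_nonneg hu0]
    _ ≤ |A| * |c| + |B| * c ^ 2 := by
        have : |B| * c ^ 2 * u ≤ |B| * c ^ 2 * 1 := by gcongr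
        linarith

/-- `Z22:§10.u040` (helper; cf. `Section10BetaProd`) the β-product remainder, EXPLICITLY:
`‖β_{j+1}β_{j+2}log P + (11−6j+j²)πα‖ ≤ πα·u·(18|c′| + 21c′²)`, `u = α𝓛 ≤ 1`.
[cite: Zhang2022LandauSiegel, §10 p. 58] -/
private theorem betaProd_remainder_le (c' : ℝ) {D : ℕ} (hℓ : 0 < ell D)
    (hu1 : alpha D * ell D ≤ 1) {j : ℕ} (hj : j ∈ ({1, 2, 3} : Finset ℕ)) :
    ‖betaJ c' D (j + 1) * betaJ c' D (j + 2) * logP D + nQuad j * π * alpha D‖ ≤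
      π * alpha D * (alpha D * ell D) * (18 * |c'| + 21 * c' ^ 2) := by
  have h9 : ell D ^ 9 ≠ 0 := pow_ne_zero _ hℓ.ne'
  have hα : alpha D = π / ell D ^ 9 := by rw [alpha, bigP, Real.log_exp]
  have hL : logP D = ell D ^ 9 := by rw [logP, bigP, Real.log_exp]
  have hα0 : 0 ≤ alpha D := by rw [hα]; positivity
  have hu0 : 0 ≤ alpha D * ell D := mul_nonneg hα0 hℓ.le
  have fin : ∀ A B : ℝ, |A| * |c'| + |B| * c' ^ 2 ≤ 18 * |c'| + 21 * c' ^ 2 →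
      |π * alpha D * (alpha D * ell D) * (A * c' + B * c' ^ 2 * (alpha D * ell D))| ≤
        π * alpha D * (alpha D * ell D) * (18 * |c'| + 21 * c' ^ 2) := by
    intro A B hAB
    refine (abs_remainder_le hα0 hu0 hu1).trans ?_
    gcongr
  simp only [Finset.mem_insert, Finset.mem_singleton] at hj
  rcases hj with rfl | rfl | rfl
  · have e : betaJ c' D (1 + 1) * betaJ c' D (1 + 2) * (logP D : ℂ) + nQuad 1 * π * alpha D =
        ((π * alpha D * (alpha D * ell D) * (0 * c' + 6 * c' ^ 2 * (alpha D * ell D)) : ℝ) : ℂ) := by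
      simp only [betaJ, beta1, beta2, beta3, nQuad, hα, hL]
      norm_num
      field_simp
      ring_nf
      simp only [Complex.I_sq]
      ring
    rw [e, Complex.norm_real, Real.norm_eq_abs]
    exact fin 0 6 (by norm_num; nlinarith [abs_nonneg c', sq_nonneg c'])
  · have e : betaJ c' D (2 + 1) * betaJ c' D (2 + 2) * (logP D : ℂ) + nQuad 2 * π * alpha D =
        ((π * alpha D * (alpha D * ell D) * (18 * c' + (-15) * c' ^ 2 * (alpha D * ell D)) : ℝ) : ℂ) := by
      simp only [betaJ, beta1, beta2, beta3, nQuad, hα, hL]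
      norm_num
      field_simp
      ring_nf
      simp only [Complex.I_sq]
      ring
    rw [e, Complex.norm_real, Real.norm_eq_abs]
    exact fin 18 (-15) (by norm_num; nlinarith [sq_nonneg c'])
  · have e : betaJ c' D (3 + 1) * betaJ c' D (3 + 2) * (logP D : ℂ) + nQuad 3 * π * alpha D =
        ((π * alpha D * (alpha D * ell D) * (8 * c' + 10 * c' ^ 2 * (alpha D * ell D)) : ℝ) : ℂ) := by
      simp only [betaJ, beta1, beta2, beta3, nQuad, hα, hL]
      norm_num
      field_simp
      ring_nf
      simp only [Complex.I_sq]
      ring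
    rw [e, Complex.norm_real, Real.norm_eq_abs]
    exact fin 8 10 (by norm_num; nlinarith [abs_nonneg c', sq_nonneg c'])

/-- `Z22:§10.u040` (helper) the EXACT identity behind "gathering the above results together":
with `L·α = π`, `α⁻¹·(B₁ + B₂ + B₃) − d3F(n,f₆,f₇,y₁,y₂)·A = (A/(500α))·(β_{j+1}β_{j+2}L + nπα)·I₁`
where `B₁ = Aβ_{j+1}β_{j+2}L/500·I₁`, `I₁ = ∫₀^{0.5}(f₆(0.004+z)/0.504 + ι₂f₇(z)/0.5)dz`, and
`B₂, B₃` are the integral forms of the two upper ranges (u037, u038). [cite: Zhang2022LandauSiegel, §10 p. 58] -/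
private theorem key1113 {A α L : ℝ} (hα : α ≠ 0) (hL : L * α = π) (b : ℂ) (n : ℕ)
    {f6 f7 y1 y2 : ℝ → ℂ} (hf6 : Continuous f6) (hy1 : Continuous y1) (hy2 : Continuous y2) :
    ((A : ℂ) * b * (L : ℂ) / 500 *
            (∫ z in (0 : ℝ)..0.5, (f6 (0.004 + z) / 0.504 + iota2 * f7 z / 0.5)) +
          500 * (A : ℂ) / (0.504 * (L : ℂ)) *
            (∫ z in (0.5 : ℝ)..0.502, f6 (0.504 - z) * (-1 + y1 z)) +
          500 * (A : ℂ) / (0.504 * (L : ℂ)) *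
            (∫ z in (0.502 : ℝ)..0.504, f6 (0.504 - z) * (1 + y2 z))) / (α : ℂ) -
        d3F n f6 f7 y1 y2 * A =
      (((A / (500 * α) : ℝ)) : ℂ) * ((b * L + n * π * α) *
        ∫ z in (0 : ℝ)..0.5, (f6 (0.004 + z) / 0.504 + iota2 * f7 z / 0.5)) := by
  rw [add_assoc, ← mul_add, subst1113 hf6 hy1 hy2, d3F]
  have hI : (∫ z in (0 : ℝ)..0.5, (((1 / 0.504 : ℝ) : ℂ) * f6 (0.004 + z) + iota2 / 0.5 * f7 z)) =
      ∫ z in (0 : ℝ)..0.5, (f6 (0.004 + z) / 0.504 + iota2 * f7 z / 0.5) :=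
    intervalIntegral.integral_congr fun z _ => by push_cast; ring
  rw [hI]
  generalize (∫ z in (0 : ℝ)..0.5, (f6 (0.004 + z) / 0.504 + iota2 * f7 z / 0.5)) = I1
  generalize (∫ u in (0 : ℝ)..0.002, (f6 u - f6 (0.002 + u))) = J
  generalize ((∫ z in (0.5 : ℝ)..0.502, f6 (0.504 - z) * y1 z) +
      ∫ z in (0.502 : ℝ)..0.504, f6 (0.504 - z) * y2 z) = Y
  have hα' : (α : ℂ) ≠ 0 := by exact_mod_cast hα
  have hπ : (π : ℂ) ≠ 0 := by exact_mod_cast Real.pi_ne_zero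
  have hL' : (L : ℂ) = π / α := by
    rw [eq_div_iff hα']
    exact_mod_cast hL
  simp only [hL']
  push_cast
  field_simp
  ring

/-- `Z22:§10.u040` (helper) the `o(α)` bookkeeping of the gathering step with a cross term. [folklore] -/
private theorem gather_bound7 {R1 R2 R3 A1 X1 B1 A2 B2 A3 B3 M E : ℂ} {α ε δ : ℝ} (hα : 0 < α)
    (e1 : ‖R1 - A1‖ ≤ δ * α) (e2 : ‖A1 - X1‖ ≤ δ * α) (e3 : ‖X1 - B1‖ ≤ δ * α)
    (e4 : ‖R2 - A2‖ ≤ δ * α) (e5 : ‖A2 - B2‖ ≤ δ * α) (e6 : ‖R3 - A3‖ ≤ δ * α)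
    (e7 : ‖A3 - B3‖ ≤ δ * α) (key : (B1 + B2 + B3) / (α : ℂ) - M = E) (hE : ‖E‖ ≤ ε / 2)
    (hδ : 7 * δ ≤ ε / 2) : ‖(R1 + R2 + R3) / (α : ℂ) - M‖ ≤ ε := by
  have h : (R1 + R2 + R3) / (α : ℂ) - M =
      ((R1 - A1) + (A1 - X1) + (X1 - B1) + (R2 - A2) + (A2 - B2) + (R3 - A3) + (A3 - B3)) / (α : ℂ)
        + E := by
    rw [← key]; ring
  rw [h]
  refine (norm_add_le _ _).trans ?_
  rw [norm_div, Complex.norm_real, Real.norm_of_nonneg hα.le]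
  have h7 : ‖(R1 - A1) + (A1 - X1) + (X1 - B1) + (R2 - A2) + (A2 - B2) + (R3 - A3) + (A3 - B3)‖ ≤
      7 * (δ * α) := by
    have := norm_add_le ((R1 - A1) + (A1 - X1) + (X1 - B1) + (R2 - A2) + (A2 - B2) + (R3 - A3)) (A3 - B3)
    have := norm_add_le ((R1 - A1) + (A1 - X1) + (X1 - B1) + (R2 - A2) + (A2 - B2)) (R3 - A3)
    have := norm_add_le ((R1 - A1) + (A1 - X1) + (X1 - B1) + (R2 - A2)) (A2 - B2)
    have := norm_add_le ((R1 - A1) + (A1 - X1) + (X1 - B1)) (R2 - A2)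
    have := norm_add_le ((R1 - A1) + (A1 - X1)) (X1 - B1)
    have := norm_add_le (R1 - A1) (A1 - X1)
    linarith
  have : ‖(R1 - A1) + (A1 - X1) + (X1 - B1) + (R2 - A2) + (A2 - B2) + (R3 - A3) + (A3 - B3)‖ / α ≤
      7 * δ := by
    rw [div_le_iff₀ hα]
    linarith
  linarith

/-- `Z22:§10.u040` EDGE (kernel-proved): **"gathering the above results together we conclude
`α⁻¹S_j(𝐚₁₁,𝐚₁₃) = d₃ⱼ𝔞 + o(1)`"** (p. 58) FOLLOWS from the typed steps of the evaluation of
`Θ₁(𝐚₁₁,𝐚₁₃)` — the expansion `IdSj1113` (u034), the split `Split1113` (u035), the three range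
evaluations `Eq1036a/b/c`, `Eq1037a/b`, `Eq1038a/b` (u036–u038) — together with "`β_{j+1}β_{j+2}log P =
−(11−6j+j²)πα + o(α)`" (u039, here in the EXPLICIT form `betaProd_remainder_le`, `O(α·𝓛⁻⁸)`) and the
tree's `𝔞 ≤ (96e⁹/π²)𝓛⁴` (`Skeleton.frakA_le_ell_pow_four`, needed because u040 claims `o(1)`, not
`o(𝔞)`: the cross term `𝔞·(β-remainder/α)·I₁/500` is `O(𝓛⁴·𝓛⁻⁸)`): the three integral forms add up to
`d₃ⱼ𝔞α` EXACTLY up to that cross term (`key1113`: `u = 0.504 − z`, `α log P = π`; `d₃ⱼ` = tree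
`d3F (11−6j+j²) 𝔣𝔣_{j6} 𝔣𝔣_{j7} 𝔶𝔶₁ⱼ 𝔶𝔶₂ⱼ` = `d3Sel j`). So u040 carries no content beyond u034–u039.
[cite: Zhang2022LandauSiegel, §10 p. 58] -/
theorem concl1113_of_ranges (c' : ℝ) (hId : IdSj1113 c') (hSplit : Split1113 c')
    (h36a : Eq1036a c') (h36b : Eq1036b c') (h36c : Eq1036c c') (h37a : Eq1037a c')
    (h37b : Eq1037b c') (h38a : Eq1038a c') (h38b : Eq1038b c') : Concl1113 c' := by
  intro ε hε
  have hε' : 0 < ε / 14 := by positivity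
  obtain ⟨D₀, hD₀⟩ :=
    ((((((h36a _ hε').and (h36b _ hε')).and (h36c _ hε')).and (h37a _ hε')).and (h37b _ hε')).and
      (h38a _ hε')).and (h38b _ hε')
  -- the constant of the cross term: `𝔞 ≤ K𝓛⁴`, `‖r‖ ≤ παu·S`, `u = π/𝓛⁸`, `‖I₁‖ ≤ 14`
  set S : ℝ := 18 * |c'| + 21 * c' ^ 2 with hS
  set K2 : ℝ := 96 * Real.exp 9 / π ^ 2 * (π * π * S) * 14 / 500 + 1 with hK2
  have hS0 : 0 ≤ S := by positivity
  have hK2pos : 0 < K2 := by positivity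
  set L0 : ℝ := max 3 (2 * K2 / ε) with hL0
  refine ⟨max D₀ ⌈Real.exp L0⌉₊, fun D _ χ hD hq hp hA j hj => ?_⟩
  obtain ⟨⟨⟨⟨⟨⟨e1, e2⟩, e3⟩, e4⟩, e5⟩, e6⟩, e7⟩ := hD₀ D χ (le_of_max_le_left hD) hq hp
  have hℓL0 : L0 ≤ ell D := le_ell_of_ceil_exp_le (le_of_max_le_right hD)
  have hℓ3 : 3 ≤ ell D := (le_max_left _ _).trans hℓL0
  have hℓK : 2 * K2 / ε ≤ ell D := (le_max_right _ _).trans hℓL0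
  have hℓ0 : 0 < ell D := by linarith
  have hℓ1 : 1 ≤ ell D := by linarith
  have hD2 : 2 ≤ D := by
    by_contra hlt
    push Not at hlt
    have : ell D ≤ Real.log 1 := by
      rw [ell]
      rcases Nat.lt_succ_iff.mp hlt |>.eq_or_lt with h | h
      · rw [h]; simp
      · have : D = 0 := by omega
        rw [this]; simp
    rw [Real.log_one] at this
    linarith
  have hα := alpha_pos hD2
  have hαL : logP D * alpha D = π := by rw [mul_comm]; exact alpha_mul_logP hD2
  have hαeq : alpha D = π / ell D ^ 9 := by rw [alpha, bigP, Real.log_exp]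
  have hu : alpha D * ell D = π / ell D ^ 8 := by
    rw [hαeq]; field_simp
  have hu1 : alpha D * ell D ≤ 1 := by
    rw [hu, div_le_one (by positivity)]
    calc π ≤ 4 := by linarith [Real.pi_lt_d2]
      _ ≤ 3 ^ 8 := by norm_num
      _ ≤ ell D ^ 8 := by gcongr
  -- the pieces
  obtain ⟨n, hn, hd3⟩ := d3Sel_eq hj
  have hr := betaProd_remainder_le c' hℓ0 hu1 hj
  rw [← hn] at hr
  have hI1 := norm_I1_le j
  have hA0 : 0 ≤ frakA χ := frakA_nonneg χ
  have hAK : frakA χ ≤ 96 * Real.exp 9 / π ^ 2 * ell D ^ 4 := frakA_le_ell_pow_four χ hℓ3 hp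
  rw [hId D χ hq j, hSplit D χ j, hd3]
  refine gather_bound7 hα (e1 hA j hj) (e2 hA j hj) (e3 hA j hj) (e4 hA j hj) (e5 hA j hj)
    (e6 hA j hj) (e7 hA j hj)
    (key1113 hα.ne' hαL (betaJ c' D (j + 1) * betaJ c' D (j + 2)) n (continuous_ffSel j 6)
      (continuous_yy1Sel j) (continuous_yy2Sel j)) ?_ (by linarith)
  -- the cross term
  rw [norm_mul, norm_mul, Complex.norm_real, Real.norm_of_nonneg (by positivity)]
  calc frakA χ / (500 * alpha D) *
        (‖betaJ c' D (j + 1) * betaJ c' D (j + 2) * (logP D : ℂ) + (n : ℂ) * π * (alpha D : ℂ)‖ *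
          ‖∫ z in (0 : ℝ)..0.5, (ffSel j 6 (0.004 + z) / 0.504 + iota2 * ffSel j 7 z / 0.5)‖)
      ≤ (96 * Real.exp 9 / π ^ 2 * ell D ^ 4) / (500 * alpha D) *
          ((π * alpha D * (alpha D * ell D) * S) * 14) := by
        gcongr
    _ = (96 * Real.exp 9 / π ^ 2 * (π * π * S) * 14 / 500) / ell D ^ 4 := by
        rw [hu]
        field_simp
    _ ≤ (K2) / ell D ^ 4 := by
        gcongr
        linarith
    _ ≤ K2 / ell D := by
        apply div_le_div_of_nonneg_left hK2pos.le hℓ0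
        calc ell D = ell D ^ 1 := (pow_one _).symm
          _ ≤ ell D ^ 4 := pow_le_pow_right₀ hℓ1 (by norm_num)
    _ ≤ ε / 2 := by
        rw [div_le_iff₀ hℓ0]
        have : 2 * K2 ≤ ell D * ε := by
          have := hℓK
          rwa [div_le_iff₀ hε] at this
        linarith

end Literature.NumberTheory.LFunctions.Zhang2022.Typed.Sec10B
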